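import Summits.Ventures.HodgeRepro2.T5SU11SphericalLegendreAll
import Summits.Ventures.HodgeRepro2.T5SU11SphericalProduct

/-!
# Legendre's product formula from the group: `P_n(cosh 2s) P_n(cosh 2t) = ∫_K P_n(cosh 2s cosh 2t + sinh 2s sinh 2t · Re u²) du`

Harish-Chandra's product formula `∫_K φ_λ(g k h) dk = φ_λ(g) φ_λ(h)` (`T5SU11SphericalProduct`) at `λ = 2n + 2`, with
`g = a_s`, `h = a_t` and `φ_{2n+2} = P_n(φ_4)` (`T5SU11SphericalLegendreAll`), is a product formula for the Legendre
polynomials once `φ_4(a_s · rot u · a_t)` is computed: the `(0,0)` entry of `a_s · rot u · a_t` is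
`u cosh s cosh t + ū sinh s sinh t` (`mat_hyp_mul_rot_mul_hyp_zero_zero`), so

  **`φ_4(a_s · rot u · a_t) = cosh 2s cosh 2t + sinh 2s sinh 2t · Re(u²)`**   (`sph_four_hyp_mul_rot_mul_hyp`)

and

  **`P_n(cosh 2s) P_n(cosh 2t) = ∫_K P_n(cosh 2s cosh 2t + sinh 2s sinh 2t · Re(u²)) du`**   (`legP_mul_legP_eq_integral`)

— with `u = e^{iθ}`, `Re(u²) = cos 2θ`, this is the classical
`P_n(x) P_n(y) = (1/π) ∫_0^π P_n(xy + √(x² − 1) √(y² − 1) cos φ) dφ` for `x, y ≥ 1`, here derived from the group structure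
of `SU(1,1)` (the integral over `K` against its normalised Haar measure). Nothing is claimed about (N).

Blind lane: Mathlib + the HodgeRepro2 prefix only; no sorry; axioms ⊆ {propext, Classical.choice,
Quot.sound}.
-/

namespace Summit.Ventures.HodgeRepro2.T5SU11SphericalLegendreProduct

open MeasureTheory Metric Set Filter Topology Complex
open T5PoincareDensity T5SU11Unimodular T5SU11Fibration T5SU11Cartan T5SU11OneParameter T5SU11CartanProjection
  T5HaarCircle T5BergmanCoefficient T5SU11SphericalFunction T5SU11SphericalSymmetry T5SU11SphericalBounds
  T5SU11SphericalLegendre T5SU11SphericalLegendreHigher T5SU11SphericalLegendreAll T5SU11SphericalProduct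

/-! ### The `(0,0)` entry of `a_s · rot u · a_t` -/

/-- **`(a_s · rot u · a_t)₀₀ = u cosh s cosh t + ū sinh s sinh t`.** -/
theorem mat_hyp_mul_rot_mul_hyp_zero_zero (s t : ℝ) (u : Circle) :
    mat (hyp s * rot u * hyp t) 0 0
      = (u : ℂ) * (Real.cosh s : ℂ) * (Real.cosh t : ℂ) + (starRingEnd ℂ) (u : ℂ) * (Real.sinh s : ℂ) * (Real.sinh t : ℂ) := by
  rw [mat_mul, mat_mul, mat_hyp, mat_hyp, show mat (rot u) = su11 (u : ℂ) 0 from coe_rot u, su11_mul, su11_mul]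
  simp only [su11, Matrix.of_apply, Matrix.cons_val', Matrix.cons_val_zero, Matrix.empty_val',
    Matrix.cons_val_fin_one, map_zero, mul_zero, add_zero, Complex.conj_ofReal]
  ring

/-- `|u C + ū S|² = C² + S² + 2 C S · Re(u²)` for real `C`, `S` and `u` on the circle. -/
theorem normSq_mul_add_conj_mul (u : Circle) (C S : ℝ) :
    Complex.normSq ((u : ℂ) * (C : ℂ) + (starRingEnd ℂ) (u : ℂ) * (S : ℂ))
      = C ^ 2 + S ^ 2 + 2 * C * S * ((u : ℂ) ^ 2).re := by
  have hu : Complex.normSq (u : ℂ) = 1 := Circle.normSq_coe u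
  rw [Complex.normSq_add, Complex.normSq_mul, Complex.normSq_mul, Complex.normSq_conj, hu,
    Complex.normSq_ofReal, Complex.normSq_ofReal]
  have e : (u : ℂ) * (C : ℂ) * (starRingEnd ℂ) ((starRingEnd ℂ) (u : ℂ) * (S : ℂ))
      = (C : ℂ) * (S : ℂ) * (u : ℂ) ^ 2 := by
    rw [map_mul, Complex.conj_conj, Complex.conj_ofReal]
    ring
  rw [e]
  simp only [one_mul, Complex.mul_re, Complex.ofReal_re, Complex.ofReal_im, mul_zero, sub_zero, zero_mul,
    Complex.mul_im, zero_add]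
  ring

section measure

variable [MeasurableSpace Circle] [BorelSpace Circle]

/-- **`φ_4(a_s · rot u · a_t) = cosh 2s cosh 2t + sinh 2s sinh 2t · Re(u²)`.** -/
theorem sph_four_hyp_mul_rot_mul_hyp (s t : ℝ) (u : Circle) :
    sph 4 (hyp s * rot u * hyp t)
      = Real.cosh (2 * s) * Real.cosh (2 * t) + Real.sinh (2 * s) * Real.sinh (2 * t) * ((u : ℂ) ^ 2).re := by
  rw [sph_four, mat_hyp_mul_rot_mul_hyp_zero_zero, ← Complex.normSq_eq_norm_sq,
    show (u : ℂ) * (Real.cosh s : ℂ) * (Real.cosh t : ℂ) + (starRingEnd ℂ) (u : ℂ) * (Real.sinh s : ℂ) * (Real.sinh t : ℂ)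
      = (u : ℂ) * ((Real.cosh s * Real.cosh t : ℝ) : ℂ) + (starRingEnd ℂ) (u : ℂ) * ((Real.sinh s * Real.sinh t : ℝ) : ℂ) by
      push_cast; ring,
    normSq_mul_add_conj_mul, Real.cosh_two_mul, Real.cosh_two_mul, Real.sinh_two_mul, Real.sinh_two_mul]
  linear_combination (Real.cosh t ^ 2 - Real.sinh t ^ 2) * Real.cosh_sq s + Real.cosh_sq t

/-- **LEGENDRE'S PRODUCT FORMULA, FROM THE GROUP**: for every `n` and all real `s`, `t`,
`P_n(cosh 2s) P_n(cosh 2t) = ∫_K P_n(cosh 2s cosh 2t + sinh 2s sinh 2t · Re(u²)) du`. -/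
theorem legP_mul_legP_eq_integral (n : ℕ) (s t : ℝ) :
    legP n (Real.cosh (2 * s)) * legP n (Real.cosh (2 * t))
      = ∫ u, legP n (Real.cosh (2 * s) * Real.cosh (2 * t) + Real.sinh (2 * s) * Real.sinh (2 * t) * ((u : ℂ) ^ 2).re)
          ∂haarCircle := by
  rw [← sph_even_hyp, ← sph_even_hyp, ← integral_sph_mul_rot_mul]
  refine integral_congr_ae (Filter.Eventually.of_forall fun u => ?_)
  simp only
  rw [sph_even_eq_sph_four, sph_four_hyp_mul_rot_mul_hyp]

end measure

end Summit.Ventures.HodgeRepro2.T5SU11SphericalLegendreProduct
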